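import Mathlib
import Summits.KontsevichZagierPeriods.KontsevichZagierPeriods.Theorems.InverseLandauTateFamilyKernelStubLinMoments

/-!
# Crux `TateFamilyKernel` (stmt-KontsevichZagierPeriods-9130), line `Sketch`: stub `stub_sfMoments`

Step 1 (MOMENTS) of the symmetric-fold linear class of the lead's skeleton of the crux
`Summit.KontsevichZagierPeriods.KontsevichZagierPeriods.Theses.InverseLandau.TateFamilyKernel`:
the Tate denominator `Q = 1 − ϖ z₁(1−z₁)(α + βz₂)` (`0 < α`, `0 < β`; variables `X 0 = z₁`,
`X 1 = z₂`, `X (Fin.last 2) = ϖ`) with a `ϖ`-free numerator `P`. If `Q ≠ 0` on `[0,1]² × (0,b)`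
and the open-square integrals `∫ P/Q(·,ϖ)` vanish for all `ϖ ∈ (0,b)`, then every moment
`μ_M = ∫_{(0,1)²} P·(z₁(1−z₁)(α+βz₂))^M` vanishes.

* Admissibility forces `ϖ(α+β)/4 < 1` on `(0,b)`: otherwise `ϖ₁ = 4/(α+β) ∈ (0,b)` and the point
  `z = (½, 1)` of the closed square give `Q = 1 − ϖ₁·¼·(α+β) = 0`
  (`SfMoments.mul_quarter_lt_one_of_adm`).
* For such `ϖ`, `T(z) = z₁(1−z₁)(α+βz₂) ∈ [0, (α+β)/4]` on the square (`z₁(1−z₁) ≤ ¼`,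
  `SfMoments.sfT_bounds`), so `P/Q = Σ_M P·(ϖT)^M` pointwise with the summable uniform domination
  `|P|·(ϖ(α+β)/4)^M`; dominated convergence for series gives `∫ P/Q(·,ϖ) = Σ_M μ_M ϖ^M`
  (`SfMoments.hasSum_sfMoments`), and `|μ_M| ≤ (∫|P|)((α+β)/4)^M` (`SfMoments.abs_sfMoment_le`).
* A real power series with coefficients `|μ_M| ≤ C R^M` whose sum vanishes on `(0,b)` is zero —
  the one-sided uniqueness of power-series coefficients `LinMoments.eq_zero_of_hasSum_Ioo` of the
  landed linear-class file (p141771), which also supplies the evaluation of the sliced numerator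
  (`LinMoments.aeval_snoc_rename_castSucc`) and the measurability / integrability of polynomials
  on the open square (`LinMoments.measurableSet_sq`, `LinMoments.integrableOn_aeval`,
  `LinMoments.continuous_aeval`).

References: Kontsevich–Zagier 2001, §1.2 (this is an elementary real-analysis step of one test
class of the period conjecture). Mathlib and the linear-class file only; no named fact, no new
definition. Helpers live in the sub-namespace `SfMoments`.
-/

noncomputable section

open MeasureTheory Set MvPolynomial

namespace Summit.KontsevichZagierPeriods.InverseLandau.TateFamilyKernel.Descent

namespace SfMoments

/-! ### Evaluation of the symmetric-fold denominator -/

/-- The symmetric-fold denominator at `(z, ϖ)`: `Q(z, ϖ) = 1 − ϖ·z₁(1−z₁)(α + βz₂)`. [folklore] -/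
theorem aeval_snoc_sfDen (α β : ℚ) (z : Fin 2 → ℝ) (ϖ : ℝ) :
    aeval (Fin.snoc z ϖ : Fin (2 + 1) → ℝ)
        (1 - X (Fin.last 2) * (X 0 * (1 - X 0)) * (C α + C β * X 1) :
          MvPolynomial (Fin (2 + 1)) ℚ) =
      1 - ϖ * (z 0 * (1 - z 0) * ((α : ℝ) + β * z 1)) := by
  have h0 : (Fin.snoc z ϖ : Fin (2 + 1) → ℝ) 0 = z 0 := rfl
  have h1 : (Fin.snoc z ϖ : Fin (2 + 1) → ℝ) 1 = z 1 := rfl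
  simp only [map_sub, map_one, map_mul, map_add, aeval_X, aeval_C, Fin.snoc_last, h0, h1,
    eq_ratCast]
  ring

/-! ### The range of `T = z₁(1−z₁)(α+βz₂)` on the open square -/

/-- On the open square, `0 ≤ z₁(1−z₁)(α+βz₂) ≤ (α+β)/4` (`0 < α`, `0 < β`): the fold
`z₁(1−z₁)` takes values in `[0, ¼]` and the weight `α+βz₂` in `[0, α+β]`. [folklore] -/
theorem sfT_bounds {α β : ℚ} (hα : 0 < α) (hβ : 0 < β) {z : Fin 2 → ℝ}
    (hz : z ∈ Set.pi Set.univ (fun _ : Fin 2 => Ioo (0 : ℝ) 1)) :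
    0 ≤ z 0 * (1 - z 0) * ((α : ℝ) + β * z 1) ∧
      z 0 * (1 - z 0) * ((α : ℝ) + β * z 1) ≤ ((α : ℝ) + β) / 4 := by
  have h0 := (mem_univ_pi.mp hz) 0
  have h1 := (mem_univ_pi.mp hz) 1
  have hα' : (0 : ℝ) < α := by exact_mod_cast hα
  have hβ' : (0 : ℝ) < β := by exact_mod_cast hβ
  have hu0 : 0 ≤ z 0 * (1 - z 0) := mul_nonneg h0.1.le (sub_nonneg.mpr h0.2.le)
  have hu1 : z 0 * (1 - z 0) ≤ 1 / 4 := by nlinarith [sq_nonneg (z 0 - 1 / 2)]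
  have hw0 : (0 : ℝ) ≤ (α : ℝ) + β * z 1 := (add_pos hα' (mul_pos hβ' h1.1)).le
  have hw1 : (α : ℝ) + β * z 1 ≤ (α : ℝ) + β := by
    have h2 := mul_le_of_le_one_right hβ'.le h1.2.le
    linarith
  refine ⟨mul_nonneg hu0 hw0, ?_⟩
  calc z 0 * (1 - z 0) * ((α : ℝ) + β * z 1) ≤ 1 / 4 * ((α : ℝ) + β) :=
        mul_le_mul hu1 hw1 hw0 (by norm_num)
    _ = ((α : ℝ) + β) / 4 := by ring

/-! ### Admissibility bounds the parameter interval -/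

/-- **`b ≤ 4/(α+β)`**: if `Q = 1 − ϖ z₁(1−z₁)(α+βz₂)` does not vanish on `[0,1]² × (0,b)`, then
`ϖ(α+β)/4 < 1` for every `ϖ ∈ (0,b)` (otherwise `ϖ₁ = 4/(α+β) ∈ (0,b)` and the point `z = (½, 1)`
of the closed square give `Q = 1 − ϖ₁·¼·(α+β) = 0`). [folklore] -/
theorem mul_quarter_lt_one_of_adm {α β : ℚ} {b : ℝ} (hα : 0 < α) (hβ : 0 < β)
    (hadm : ∀ (z : Fin 2 → ℝ) (ϖ : ℝ), (∀ t, z t ∈ Icc (0 : ℝ) 1) → ϖ ∈ Ioo 0 b →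
      aeval (Fin.snoc z ϖ : Fin (2 + 1) → ℝ)
        (1 - X (Fin.last 2) * (X 0 * (1 - X 0)) * (C α + C β * X 1) :
          MvPolynomial (Fin (2 + 1)) ℚ) ≠ 0)
    {ϖ : ℝ} (hϖ : ϖ ∈ Ioo 0 b) : ϖ * (((α : ℝ) + β) / 4) < 1 := by
  have hαβ : (0 : ℝ) < (α : ℝ) + β := by exact_mod_cast add_pos hα hβ
  have hαβ4 : (0 : ℝ) < ((α : ℝ) + β) / 4 := by positivity
  refine not_le.mp fun h => ?_
  have hle : 1 / (((α : ℝ) + β) / 4) ≤ ϖ := (div_le_iff₀ hαβ4).mpr h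
  have hϖ₁ : 1 / (((α : ℝ) + β) / 4) ∈ Ioo 0 b := ⟨one_div_pos.mpr hαβ4, hle.trans_lt hϖ.2⟩
  refine hadm ![1 / 2, 1] _ (fun t => ?_) hϖ₁ ?_
  · fin_cases t
    · exact ⟨by norm_num, by norm_num⟩
    · exact ⟨by norm_num, by norm_num⟩
  have hne : (α : ℝ) + β ≠ 0 := hαβ.ne'
  rw [aeval_snoc_sfDen]
  simp only [Matrix.cons_val_zero, Matrix.cons_val_one, Matrix.cons_val_fin_one]
  field_simp
  ring

/-! ### The power-series expansion of the fibre integral -/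

/-- **Geometric bound on the moments**: `|∫_□ P·T^M| ≤ (∫_□ |P|)((α+β)/4)^M` for
`T = z₁(1−z₁)(α+βz₂)`. [folklore] -/
theorem abs_sfMoment_le {α β : ℚ} (hα : 0 < α) (hβ : 0 < β) (P : MvPolynomial (Fin 2) ℚ)
    (M : ℕ) :
    |∫ z in Set.pi Set.univ (fun _ : Fin 2 => Ioo (0 : ℝ) 1),
        aeval z P * (z 0 * (1 - z 0) * ((α : ℝ) + β * z 1)) ^ M| ≤
      (∫ z in Set.pi Set.univ (fun _ : Fin 2 => Ioo (0 : ℝ) 1), ‖aeval z P‖) *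
        (((α : ℝ) + β) / 4) ^ M := by
  rw [← Real.norm_eq_abs, ← integral_mul_const]
  refine norm_integral_le_of_norm_le ((LinMoments.integrableOn_aeval P).norm.mul_const _) ?_
  refine ae_restrict_of_forall_mem LinMoments.measurableSet_sq fun z hz => ?_
  have hT := sfT_bounds hα hβ hz
  rw [norm_mul, norm_pow, Real.norm_of_nonneg hT.1]
  exact mul_le_mul_of_nonneg_left (pow_le_pow_left₀ hT.1 hT.2 M) (norm_nonneg _)

/-- **Power-series expansion of the fibre integral.** For `0 ≤ ϖ` with `ϖ(α+β)/4 < 1`,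
`Σ_M (∫_□ P·T^M) ϖ^M = ∫_□ P/(1 − ϖT)`, `T = z₁(1−z₁)(α+βz₂)`: on the square
`0 ≤ ϖT ≤ ϖ(α+β)/4 < 1`, so `P/(1 − ϖT) = Σ_M P(ϖT)^M` pointwise with the summable uniform
domination `|P|(ϖ(α+β)/4)^M`, and dominated convergence for series applies. [folklore] -/
theorem hasSum_sfMoments {α β : ℚ} (hα : 0 < α) (hβ : 0 < β) (P : MvPolynomial (Fin 2) ℚ)
    {ϖ : ℝ} (hϖ0 : 0 ≤ ϖ) (hϖ1 : ϖ * (((α : ℝ) + β) / 4) < 1) :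
    HasSum (fun M : ℕ => (∫ z in Set.pi Set.univ (fun _ : Fin 2 => Ioo (0 : ℝ) 1),
        aeval z P * (z 0 * (1 - z 0) * ((α : ℝ) + β * z 1)) ^ M) * ϖ ^ M)
      (∫ z in Set.pi Set.univ (fun _ : Fin 2 => Ioo (0 : ℝ) 1),
        aeval z P / (1 - ϖ * (z 0 * (1 - z 0) * ((α : ℝ) + β * z 1)))) := by
  set q : ℝ := ϖ * (((α : ℝ) + β) / 4) with hq
  have hαβ : (0 : ℝ) < (α : ℝ) + β := by exact_mod_cast add_pos hα hβ
  have hq0 : 0 ≤ q := mul_nonneg hϖ0 (div_nonneg hαβ.le (by norm_num))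
  simp_rw [← integral_mul_const]
  refine hasSum_integral_of_dominated_convergence (fun M z => ‖aeval z P‖ * q ^ M)
    (fun M => ?_) (fun M => ?_) ?_ ?_ ?_
  · have hc : Continuous fun z : Fin 2 → ℝ => (z 0 * (1 - z 0) * ((α : ℝ) + β * z 1)) ^ M := by
      fun_prop
    have hF : Continuous ((fun z : Fin 2 → ℝ => aeval z P) *
        (fun z : Fin 2 → ℝ => (z 0 * (1 - z 0) * ((α : ℝ) + β * z 1)) ^ M) * fun _ => ϖ ^ M) :=
      ((LinMoments.continuous_aeval P).mul hc).mul continuous_const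
    exact hF.aestronglyMeasurable
  · refine ae_restrict_of_forall_mem LinMoments.measurableSet_sq fun z hz => ?_
    have hT := sfT_bounds hα hβ hz
    rw [norm_mul, norm_mul, norm_pow, norm_pow, Real.norm_of_nonneg hT.1,
      Real.norm_of_nonneg hϖ0, mul_assoc, ← mul_pow]
    refine mul_le_mul_of_nonneg_left (pow_le_pow_left₀ (mul_nonneg hT.1 hϖ0) ?_ M)
      (norm_nonneg _)
    calc z 0 * (1 - z 0) * ((α : ℝ) + β * z 1) * ϖ ≤ ((α : ℝ) + β) / 4 * ϖ :=
          mul_le_mul_of_nonneg_right hT.2 hϖ0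
      _ = q := by rw [hq]; ring
  · exact Filter.Eventually.of_forall fun z =>
      (summable_geometric_of_lt_one hq0 hϖ1).mul_left _
  · simp_rw [tsum_mul_left, tsum_geometric_of_lt_one hq0 hϖ1]
    exact (LinMoments.integrableOn_aeval P).norm.mul_const _
  · refine ae_restrict_of_forall_mem LinMoments.measurableSet_sq fun z hz => ?_
    have hT := sfT_bounds hα hβ hz
    have hr1 : ϖ * (z 0 * (1 - z 0) * ((α : ℝ) + β * z 1)) < 1 :=
      lt_of_le_of_lt (mul_le_mul_of_nonneg_left hT.2 hϖ0) hϖ1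
    have h := (hasSum_geometric_of_lt_one (mul_nonneg hϖ0 hT.1) hr1).mul_left (aeval z P)
    have hfun : (fun n : ℕ => aeval z P * (z 0 * (1 - z 0) * ((α : ℝ) + β * z 1)) ^ n * ϖ ^ n) =
        fun n : ℕ => aeval z P * (ϖ * (z 0 * (1 - z 0) * ((α : ℝ) + β * z 1))) ^ n := by
      funext n
      rw [mul_pow ϖ]
      ring
    rw [hfun, div_eq_mul_inv]
    exact h

end SfMoments

/-- STUB `stub_sfMoments` (symmetric-fold class, step 1: MOMENTS). For
`Q = 1 − ϖ z₁(1−z₁)(α + βz₂)` (`0 < α`, `0 < β`) non-vanishing on `[0,1]² × (0,b)` and a `ϖ`-free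
numerator `P` whose open-square fibre integrals `∫_{(0,1)²} P/Q(·,ϖ)` vanish for all `ϖ ∈ (0,b)`,
every moment `∫_{(0,1)²} P·(z₁(1−z₁)(α+βz₂))^M` vanishes: admissibility gives `ϖ(α+β)/4 < 1` on
`(0,b)` (test point `z = (½, 1)`, `SfMoments.mul_quarter_lt_one_of_adm`), the geometric series
and dominated convergence expand the fibre integral as the power series `Σ_M μ_M ϖ^M` with
`|μ_M| ≤ (∫|P|)((α+β)/4)^M` (`SfMoments.hasSum_sfMoments`, `SfMoments.abs_sfMoment_le`), and a
real power series vanishing on `(0,b)` has all coefficients zero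
(`LinMoments.eq_zero_of_hasSum_Ioo`, isolated zeros). [cite: KontsevichZagier2001, §1.2] -/
theorem stub_sfMoments (α β : ℚ) (P : MvPolynomial (Fin 2) ℚ) (b : ℝ) (hα : 0 < α) (hβ : 0 < β)
    (hb : 0 < b)
    (hadm : ∀ (z : Fin 2 → ℝ) (ϖ : ℝ), (∀ t, z t ∈ Icc (0 : ℝ) 1) → ϖ ∈ Ioo 0 b →
      aeval (Fin.snoc z ϖ : Fin (2 + 1) → ℝ)
        (1 - X (Fin.last 2) * (X 0 * (1 - X 0)) * (C α + C β * X 1) : MvPolynomial (Fin (2 + 1)) ℚ) ≠ 0)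
    (hvan : ∀ ϖ ∈ Ioo 0 b, ∫ z in Set.pi Set.univ (fun _ : Fin 2 => Ioo (0 : ℝ) 1),
      aeval (Fin.snoc z ϖ : Fin (2 + 1) → ℝ) (rename Fin.castSucc P) /
        aeval (Fin.snoc z ϖ : Fin (2 + 1) → ℝ)
          (1 - X (Fin.last 2) * (X 0 * (1 - X 0)) * (C α + C β * X 1) : MvPolynomial (Fin (2 + 1)) ℚ) = 0) :
    ∀ M : ℕ, ∫ z in Set.pi Set.univ (fun _ : Fin 2 => Ioo (0 : ℝ) 1),
      aeval z P * (z 0 * (1 - z 0) * ((α : ℝ) + β * z 1)) ^ M = 0 := by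
  have hαβ : (0 : ℝ) < (α : ℝ) + β := by exact_mod_cast add_pos hα hβ
  have hαβ4 : (0 : ℝ) < ((α : ℝ) + β) / 4 := by positivity
  refine LinMoments.eq_zero_of_hasSum_Ioo hαβ4 hb (fun M => SfMoments.abs_sfMoment_le hα hβ P M)
    fun ϖ hϖ => ?_
  have h := SfMoments.hasSum_sfMoments hα hβ P hϖ.1.le
    (SfMoments.mul_quarter_lt_one_of_adm hα hβ hadm hϖ)
  have h0 := hvan ϖ hϖ
  simp only [LinMoments.aeval_snoc_rename_castSucc, SfMoments.aeval_snoc_sfDen] at h0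
  rwa [h0] at h

end Summit.KontsevichZagierPeriods.InverseLandau.TateFamilyKernel.Descent
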